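import Summits.ValiantsHypothesis.ValiantsHypothesis.Theorems.RigidityForcesSymmetryGrenetFirstOrderRankRigidBlockIIE1
import Summits.ValiantsHypothesis.ValiantsHypothesis.Theorems.RigidityForcesSymmetryGrenetFirstOrderRankRigidBlockIIE23
import Summits.ValiantsHypothesis.ValiantsHypothesis.Theorems.RigidityForcesSymmetryGrenetFirstOrderRankRigidDesignPerms
import Summits.ValiantsHypothesis.ValiantsHypothesis.Theorems.RigidityForcesSymmetryGrenetFirstOrderRankRigidBlockIIFilterAlgebra
import Summits.ValiantsHypothesis.ValiantsHypothesis.Theorems.RigidityForcesSymmetryGrenetFirstOrderRankRigidBlockIeq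
import Summits.ValiantsHypothesis.ValiantsHypothesis.Theorems.RigidityForcesSymmetryGrenetFirstOrderRankRigidConstGauge

/-!
# Route RigidityForcesSymmetry — `GrenetFirstOrderRankRigid` (item stmt-ValiantsHypothesis-21029),
line `grenet_gauge`: stub `stub_blockII` (ex `stub_linearRigid`) — (D-PQ) for the overlap blocks of type II

For the crux line `Cruxes/GrenetFirstOrderRankRigid/Lines/grenet_gauge.lean` (blueprint
`Lines/grenet_gauge-stub_linearRigid-PROOF.md`, §5, block II; NOTES "TYPE II FORMAL PLAN").
`grenet_blockII_PQ`: for a homogeneous direction `A'` that is Zariski-tangent at Grenet's pencil and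
supported on the tail/head positions, over an integral domain of characteristic zero, a genuine tail
entry `(i, j, v)` and a genuine head entry `(i', j', v')` of a pair `(U, T)` with `T ⊆ U`
(`U = R i + v.1 = R i'`, `T = C j = C j' - v'.1`) satisfy `A' v' i' j' = - A' v i j`.
For `|T| = |U|` this is `grenet_blockIeq_PQ`; for `T ⊊ U` it is the algebra of the overlap block
`(U \ T, |T|)` (`blockII_filterAlgebra`) fed with the designs E1 (`grenet_blockII_E1`, all cores), E2 and
E3 (`grenet_blockII_E2/E3`) at the orderings of `…DesignPerms`.  This is the binder `hII` of
`grenet_linearRigid_of_blockII_PQ` (…Borders, val-width-21029-p3) verbatim, hence the last stub of the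
line.  No new definitions.  VP ≠ VNP is not moved by this file.
-/

noncomputable section

open MvPolynomial Matrix Finset

namespace Summit.ValiantsHypothesis.Theorems.RigidityForcesSymmetry.GrenetGauge

open Literature.Computability.AlgebraicComplexity

variable {k : Type*} [CommRing k] [IsDomain k] [CharZero k] {n N : ℕ} (e : Finset (Fin n) ≃ Fin (N + 1))

set_option maxHeartbeats 800000 in
/-- **(D-PQ) for the blocks of type II** — the binder `hII` of `grenet_linearRigid_of_blockII_PQ`.
For a homogeneous tangent direction supported on the tail/head positions (characteristic zero), a
genuine tail entry `(i, j, v)` and a genuine head entry `(i', j', v')` of a pair `T ⊆ U` satisfy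
`A' v' i' j' = -A' v i j`. [cite: Grenet2011, Thm. 1] -/
theorem grenet_blockII_PQ (hn : n ≠ 0) (hN : 2 ^ n = N + 1)
    (A' : Fin n × Fin n → Matrix (Fin N) (Fin N) k)
    (htr : ((Grenet.repr k n e).adjugate * ∑ v, (X v : MvPolynomial (Fin n × Fin n) k) • (A' v).map C).trace = 0)
    (hsupp : ∀ (w : Fin n × Fin n) (a b : Fin N), A' w a b ≠ 0 →
      (w.1 ∉ e.symm ((e univ).succAbove a) ∧ (w.2 : ℕ) = (e.symm ((e univ).succAbove a)).card) ∨
      (w.1 ∈ e.symm ((e ∅).succAbove b) ∧ (e.symm ((e ∅).succAbove b)).card = (w.2 : ℕ) + 1))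
    (i j : Fin N) (v : Fin n × Fin n) (i' j' : Fin N) (v' : Fin n × Fin n)
    (ht : v.1 ∉ e.symm ((e univ).succAbove i) ∧ (v.2 : ℕ) = (e.symm ((e univ).succAbove i)).card)
    (hnh : ¬ (v.1 ∈ e.symm ((e ∅).succAbove j) ∧ (e.symm ((e ∅).succAbove j)).card = (v.2 : ℕ) + 1))
    (hh : v'.1 ∈ e.symm ((e ∅).succAbove j') ∧ (e.symm ((e ∅).succAbove j')).card = (v'.2 : ℕ) + 1)
    (hnt : ¬ (v'.1 ∉ e.symm ((e univ).succAbove i') ∧ (v'.2 : ℕ) = (e.symm ((e univ).succAbove i')).card))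
    (hU : insert v.1 (e.symm ((e univ).succAbove i)) = e.symm ((e univ).succAbove i'))
    (hT : e.symm ((e ∅).succAbove j) = (e.symm ((e ∅).succAbove j')).erase v'.1)
    (hsub : e.symm ((e ∅).succAbove j) ⊆ e.symm ((e univ).succAbove i')) :
    A' v' i' j' = -A' v i j := by
  classical
  -- the square case `|T| = |U|`
  rcases Nat.lt_or_ge (e.symm ((e ∅).succAbove j)).card (e.symm ((e univ).succAbove i')).card with hlt | hge
  swap
  · exact grenet_blockIeq_PQ e hn hN A' htr i j v i' j' v' ht.1 ht.2 hnh hh.1 hh.2 hnt hU hT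
      (le_antisymm hge (Finset.card_le_card hsub))
  -- names
  have hRinj : ∀ a b : Fin N, e.symm ((e univ).succAbove a) = e.symm ((e univ).succAbove b) → a = b :=
    fun a b h => Fin.succAbove_right_injective (e.symm.injective h)
  have hCinj : ∀ a b : Fin N, e.symm ((e ∅).succAbove a) = e.symm ((e ∅).succAbove b) → a = b :=
    fun a b h => Fin.succAbove_right_injective (e.symm.injective h)
  obtain ⟨T, hTdef⟩ : ∃ T, e.symm ((e ∅).succAbove j) = T := ⟨_, rfl⟩
  obtain ⟨U, hUdef⟩ : ∃ U, e.symm ((e univ).succAbove i') = U := ⟨_, rfl⟩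
  rw [hTdef, hUdef] at hlt hsub
  rw [hTdef] at hT hnh
  rw [hUdef] at hU hnt
  have hUne : U ≠ univ := hUdef ▸ grenet_row_ne_univ e i'
  have hTne : T ≠ ∅ := hTdef ▸ grenet_col_ne_empty e j
  have hS : e.symm ((e univ).succAbove i) = U.erase v.1 := by rw [← hU, Finset.erase_insert ht.1]
  have hCj' : e.symm ((e ∅).succAbove j') = insert v'.1 T := by rw [hT, Finset.insert_erase hh.1]
  have hp'T : v'.1 ∉ T := by rw [hT]; exact Finset.notMem_erase _ _
  have hpU : v.1 ∈ U := by rw [← hU]; exact Finset.mem_insert_self _ _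
  obtain ⟨A, hAdef⟩ : ∃ A, U \ T = A := ⟨_, rfl⟩
  obtain ⟨k₀, hTk⟩ : ∃ k₀, T.card = k₀ := ⟨_, rfl⟩
  obtain ⟨u, hUu⟩ : ∃ u, U.card = u := ⟨_, rfl⟩
  have hAU : A ∪ T = U := by rw [← hAdef, Finset.sdiff_union_of_subset hsub]
  have hTA : T ⊆ Aᶜ := fun x hx => Finset.mem_compl.mpr (by rw [← hAdef, Finset.mem_sdiff]; exact fun h => h.2 hx)
  have hdisj : Disjoint A T := Finset.disjoint_left.mpr fun x hxA hxT => (Finset.mem_compl.mp (hTA hxT)) hxA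
  have hAsubU : A ⊆ U := by rw [← hAU]; exact Finset.subset_union_left
  have huA : A.card + k₀ = u := by rw [← hUu, ← hAU, Finset.card_union_of_disjoint hdisj, hTk]
  have hA : 0 < A.card := by rw [hTk, hUu] at hlt; omega
  have hun : u < n := by
    rw [← hUu]
    have := Finset.card_lt_card (Finset.ssubset_univ_iff.mpr hUne)
    rwa [Finset.card_univ, Fintype.card_fin] at this
  have hk1 : 0 < k₀ := by rw [← hTk]; exact Finset.card_pos.mpr (Finset.nonempty_iff_ne_empty.mpr hTne)
  have hu : u ≤ n := hun.le
  have hul : u - 1 < n := by omega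
  have hkn : k₀ < n := by omega
  have hAne : A.Nonempty := Finset.card_pos.mp hA
  have hTne' : T.Nonempty := Finset.nonempty_iff_ne_empty.mpr hTne
  have hScard : (e.symm ((e univ).succAbove i)).card = u - 1 := by
    rw [hS, Finset.card_erase_of_mem hpU, hUu]
  have hv2 : (v.2 : ℕ) = u - 1 := by rw [ht.2, hScard]
  have hv'2 : (v'.2 : ℕ) = k₀ := by
    have := hh.2; rw [hCj', Finset.card_insert_of_notMem hp'T, hTk] at this; omega
  -- the set of cores and its size
  have hT𝒞 : T ∈ Finset.powersetCard k₀ Aᶜ := Finset.mem_powersetCard.mpr ⟨hTA, hTk⟩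
  obtain ⟨φ₀, hφ₀⟩ := hTne'
  obtain ⟨g₀, hg₀⟩ : ∃ g, g ∉ U := by
    by_contra h; push Not at h; exact hUne (Finset.eq_univ_of_forall h)
  have h2 : 2 ≤ (Finset.powersetCard k₀ Aᶜ).card := by
    have hg₀T : g₀ ∉ T := fun h => hg₀ (hsub h)
    have hT' : insert g₀ (T.erase φ₀) ∈ Finset.powersetCard k₀ Aᶜ := by
      refine Finset.mem_powersetCard.mpr ⟨Finset.insert_subset (Finset.mem_compl.mpr fun h => hg₀ (hAsubU h))
        ((Finset.erase_subset _ _).trans hTA), ?_⟩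
      rw [Finset.card_insert_of_notMem (fun h => hg₀T (Finset.mem_of_mem_erase h)), Finset.card_erase_of_mem hφ₀, hTk]
      omega
    have hne : insert g₀ (T.erase φ₀) ≠ T := fun h => hg₀T (h ▸ Finset.mem_insert_self _ _)
    exact Finset.one_lt_card_iff.mpr ⟨_, _, hT', hT𝒞, hne⟩
  -- reshaping of filters
  have swapT : ∀ (C₀ : Finset (Fin n)) (q : Fin n),
      (univ.filter fun x : Fin N × Fin N × (Fin n × Fin n) => (x.2.2.1 ∉ e.symm ((e univ).succAbove x.1) ∧ e.symm ((e ∅).succAbove x.2.1) ⊆ Aᶜ ∧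
        (e.symm ((e ∅).succAbove x.2.1)).card = k₀ ∧
        insert x.2.2.1 (e.symm ((e univ).succAbove x.1)) = A ∪ e.symm ((e ∅).succAbove x.2.1) ∧ (x.2.2.2 : ℕ) = u - 1) ∧ (x.2.2.1 = q ∧ e.symm ((e ∅).succAbove x.2.1) = C₀))
        = univ.filter fun x : Fin N × Fin N × (Fin n × Fin n) => (x.2.2.1 ∉ e.symm ((e univ).succAbove x.1) ∧ e.symm ((e ∅).succAbove x.2.1) ⊆ Aᶜ ∧
        (e.symm ((e ∅).succAbove x.2.1)).card = k₀ ∧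
        insert x.2.2.1 (e.symm ((e univ).succAbove x.1)) = A ∪ e.symm ((e ∅).succAbove x.2.1) ∧ (x.2.2.2 : ℕ) = u - 1) ∧ (e.symm ((e ∅).succAbove x.2.1) = C₀ ∧ x.2.2.1 = q) :=
    fun C₀ q => Finset.filter_congr fun x _ => ⟨fun ⟨a, b, c⟩ => ⟨a, c, b⟩, fun ⟨a, b, c⟩ => ⟨a, c, b⟩⟩
  have splitT : ∀ (C₀ : Finset (Fin n)) (q : Fin n),
      (∑ x ∈ univ.filter (fun x : Fin N × Fin N × (Fin n × Fin n) => (x.2.2.1 ∉ e.symm ((e univ).succAbove x.1) ∧ e.symm ((e ∅).succAbove x.2.1) ⊆ Aᶜ ∧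
        (e.symm ((e ∅).succAbove x.2.1)).card = k₀ ∧
        insert x.2.2.1 (e.symm ((e univ).succAbove x.1)) = A ∪ e.symm ((e ∅).succAbove x.2.1) ∧ (x.2.2.2 : ℕ) = u - 1) ∧ (x.2.2.1 = q ∧ e.symm ((e ∅).succAbove x.2.1) ≠ C₀)), A' x.2.2 x.1 x.2.1) = ∑ x ∈ univ.filter (fun x : Fin N × Fin N × (Fin n × Fin n) => (x.2.2.1 ∉ e.symm ((e univ).succAbove x.1) ∧ e.symm ((e ∅).succAbove x.2.1) ⊆ Aᶜ ∧
        (e.symm ((e ∅).succAbove x.2.1)).card = k₀ ∧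
        insert x.2.2.1 (e.symm ((e univ).succAbove x.1)) = A ∪ e.symm ((e ∅).succAbove x.2.1) ∧ (x.2.2.2 : ℕ) = u - 1) ∧ (x.2.2.1 = q)), A' x.2.2 x.1 x.2.1 - (∑ x ∈ univ.filter (fun x : Fin N × Fin N × (Fin n × Fin n) => (x.2.2.1 ∉ e.symm ((e univ).succAbove x.1) ∧ e.symm ((e ∅).succAbove x.2.1) ⊆ Aᶜ ∧
        (e.symm ((e ∅).succAbove x.2.1)).card = k₀ ∧
        insert x.2.2.1 (e.symm ((e univ).succAbove x.1)) = A ∪ e.symm ((e ∅).succAbove x.2.1) ∧ (x.2.2.2 : ℕ) = u - 1) ∧ (e.symm ((e ∅).succAbove x.2.1) = C₀ ∧ x.2.2.1 = q)), A' x.2.2 x.1 x.2.1) := by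
    intro C₀ q
    rw [← Finset.sum_filter_add_sum_filter_not (univ.filter fun x : Fin N × Fin N × (Fin n × Fin n) => (x.2.2.1 ∉ e.symm ((e univ).succAbove x.1) ∧ e.symm ((e ∅).succAbove x.2.1) ⊆ Aᶜ ∧
        (e.symm ((e ∅).succAbove x.2.1)).card = k₀ ∧
        insert x.2.2.1 (e.symm ((e univ).succAbove x.1)) = A ∪ e.symm ((e ∅).succAbove x.2.1) ∧ (x.2.2.2 : ℕ) = u - 1) ∧ x.2.2.1 = q)
      (fun x : Fin N × Fin N × (Fin n × Fin n) => e.symm ((e ∅).succAbove x.2.1) = C₀), Finset.filter_filter, Finset.filter_filter,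
      Finset.filter_congr (show ∀ x ∈ (univ : Finset (Fin N × Fin N × (Fin n × Fin n))), (((x.2.2.1 ∉ e.symm ((e univ).succAbove x.1) ∧ e.symm ((e ∅).succAbove x.2.1) ⊆ Aᶜ ∧
        (e.symm ((e ∅).succAbove x.2.1)).card = k₀ ∧
        insert x.2.2.1 (e.symm ((e univ).succAbove x.1)) = A ∪ e.symm ((e ∅).succAbove x.2.1) ∧ (x.2.2.2 : ℕ) = u - 1) ∧ x.2.2.1 = q) ∧ e.symm ((e ∅).succAbove x.2.1) = C₀) ↔
        ((x.2.2.1 ∉ e.symm ((e univ).succAbove x.1) ∧ e.symm ((e ∅).succAbove x.2.1) ⊆ Aᶜ ∧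
        (e.symm ((e ∅).succAbove x.2.1)).card = k₀ ∧
        insert x.2.2.1 (e.symm ((e univ).succAbove x.1)) = A ∪ e.symm ((e ∅).succAbove x.2.1) ∧ (x.2.2.2 : ℕ) = u - 1) ∧ (e.symm ((e ∅).succAbove x.2.1) = C₀ ∧ x.2.2.1 = q)) from fun x _ => ⟨fun ⟨⟨a, b⟩, c⟩ => ⟨a, c, b⟩, fun ⟨a, c, b⟩ => ⟨⟨a, b⟩, c⟩⟩),
      Finset.filter_congr (show ∀ x ∈ (univ : Finset (Fin N × Fin N × (Fin n × Fin n))), (((x.2.2.1 ∉ e.symm ((e univ).succAbove x.1) ∧ e.symm ((e ∅).succAbove x.2.1) ⊆ Aᶜ ∧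
        (e.symm ((e ∅).succAbove x.2.1)).card = k₀ ∧
        insert x.2.2.1 (e.symm ((e univ).succAbove x.1)) = A ∪ e.symm ((e ∅).succAbove x.2.1) ∧ (x.2.2.2 : ℕ) = u - 1) ∧ x.2.2.1 = q) ∧ ¬ e.symm ((e ∅).succAbove x.2.1) = C₀) ↔
        ((x.2.2.1 ∉ e.symm ((e univ).succAbove x.1) ∧ e.symm ((e ∅).succAbove x.2.1) ⊆ Aᶜ ∧
        (e.symm ((e ∅).succAbove x.2.1)).card = k₀ ∧
        insert x.2.2.1 (e.symm ((e univ).succAbove x.1)) = A ∪ e.symm ((e ∅).succAbove x.2.1) ∧ (x.2.2.2 : ℕ) = u - 1) ∧ (x.2.2.1 = q ∧ e.symm ((e ∅).succAbove x.2.1) ≠ C₀)) from fun x _ => ⟨fun ⟨⟨a, b⟩, c⟩ => ⟨a, b, c⟩, fun ⟨a, b, c⟩ => ⟨⟨a, b⟩, c⟩⟩)]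
    ring
  have splitH : ∀ (C₀ : Finset (Fin n)) (q : Fin n),
      (∑ x ∈ univ.filter (fun x : Fin N × Fin N × (Fin n × Fin n) => (x.2.2.1 ∈ e.symm ((e ∅).succAbove x.2.1) ∧ (e.symm ((e ∅).succAbove x.2.1)).erase x.2.2.1 ⊆ Aᶜ ∧
        ((e.symm ((e ∅).succAbove x.2.1)).erase x.2.2.1).card = k₀ ∧
        e.symm ((e univ).succAbove x.1) = A ∪ (e.symm ((e ∅).succAbove x.2.1)).erase x.2.2.1 ∧ (x.2.2.2 : ℕ) = k₀) ∧ (x.2.2.1 = q ∧ (e.symm ((e ∅).succAbove x.2.1)).erase x.2.2.1 ≠ C₀)), A' x.2.2 x.1 x.2.1) = ∑ x ∈ univ.filter (fun x : Fin N × Fin N × (Fin n × Fin n) => (x.2.2.1 ∈ e.symm ((e ∅).succAbove x.2.1) ∧ (e.symm ((e ∅).succAbove x.2.1)).erase x.2.2.1 ⊆ Aᶜ ∧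
        ((e.symm ((e ∅).succAbove x.2.1)).erase x.2.2.1).card = k₀ ∧
        e.symm ((e univ).succAbove x.1) = A ∪ (e.symm ((e ∅).succAbove x.2.1)).erase x.2.2.1 ∧ (x.2.2.2 : ℕ) = k₀) ∧ (x.2.2.1 = q)), A' x.2.2 x.1 x.2.1 - (∑ x ∈ univ.filter (fun x : Fin N × Fin N × (Fin n × Fin n) => (x.2.2.1 ∈ e.symm ((e ∅).succAbove x.2.1) ∧ (e.symm ((e ∅).succAbove x.2.1)).erase x.2.2.1 ⊆ Aᶜ ∧
        ((e.symm ((e ∅).succAbove x.2.1)).erase x.2.2.1).card = k₀ ∧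
        e.symm ((e univ).succAbove x.1) = A ∪ (e.symm ((e ∅).succAbove x.2.1)).erase x.2.2.1 ∧ (x.2.2.2 : ℕ) = k₀) ∧ ((e.symm ((e ∅).succAbove x.2.1)).erase x.2.2.1 = C₀ ∧ x.2.2.1 = q)), A' x.2.2 x.1 x.2.1) := by
    intro C₀ q
    rw [← Finset.sum_filter_add_sum_filter_not (univ.filter fun x : Fin N × Fin N × (Fin n × Fin n) => (x.2.2.1 ∈ e.symm ((e ∅).succAbove x.2.1) ∧ (e.symm ((e ∅).succAbove x.2.1)).erase x.2.2.1 ⊆ Aᶜ ∧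
        ((e.symm ((e ∅).succAbove x.2.1)).erase x.2.2.1).card = k₀ ∧
        e.symm ((e univ).succAbove x.1) = A ∪ (e.symm ((e ∅).succAbove x.2.1)).erase x.2.2.1 ∧ (x.2.2.2 : ℕ) = k₀) ∧ x.2.2.1 = q)
      (fun x : Fin N × Fin N × (Fin n × Fin n) => (e.symm ((e ∅).succAbove x.2.1)).erase x.2.2.1 = C₀), Finset.filter_filter, Finset.filter_filter,
      Finset.filter_congr (show ∀ x ∈ (univ : Finset (Fin N × Fin N × (Fin n × Fin n))), (((x.2.2.1 ∈ e.symm ((e ∅).succAbove x.2.1) ∧ (e.symm ((e ∅).succAbove x.2.1)).erase x.2.2.1 ⊆ Aᶜ ∧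
        ((e.symm ((e ∅).succAbove x.2.1)).erase x.2.2.1).card = k₀ ∧
        e.symm ((e univ).succAbove x.1) = A ∪ (e.symm ((e ∅).succAbove x.2.1)).erase x.2.2.1 ∧ (x.2.2.2 : ℕ) = k₀) ∧ x.2.2.1 = q) ∧ (e.symm ((e ∅).succAbove x.2.1)).erase x.2.2.1 = C₀) ↔
        ((x.2.2.1 ∈ e.symm ((e ∅).succAbove x.2.1) ∧ (e.symm ((e ∅).succAbove x.2.1)).erase x.2.2.1 ⊆ Aᶜ ∧
        ((e.symm ((e ∅).succAbove x.2.1)).erase x.2.2.1).card = k₀ ∧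
        e.symm ((e univ).succAbove x.1) = A ∪ (e.symm ((e ∅).succAbove x.2.1)).erase x.2.2.1 ∧ (x.2.2.2 : ℕ) = k₀) ∧ ((e.symm ((e ∅).succAbove x.2.1)).erase x.2.2.1 = C₀ ∧ x.2.2.1 = q)) from fun x _ => ⟨fun ⟨⟨a, b⟩, c⟩ => ⟨a, c, b⟩, fun ⟨a, c, b⟩ => ⟨⟨a, b⟩, c⟩⟩),
      Finset.filter_congr (show ∀ x ∈ (univ : Finset (Fin N × Fin N × (Fin n × Fin n))), (((x.2.2.1 ∈ e.symm ((e ∅).succAbove x.2.1) ∧ (e.symm ((e ∅).succAbove x.2.1)).erase x.2.2.1 ⊆ Aᶜ ∧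
        ((e.symm ((e ∅).succAbove x.2.1)).erase x.2.2.1).card = k₀ ∧
        e.symm ((e univ).succAbove x.1) = A ∪ (e.symm ((e ∅).succAbove x.2.1)).erase x.2.2.1 ∧ (x.2.2.2 : ℕ) = k₀) ∧ x.2.2.1 = q) ∧ ¬ (e.symm ((e ∅).succAbove x.2.1)).erase x.2.2.1 = C₀) ↔
        ((x.2.2.1 ∈ e.symm ((e ∅).succAbove x.2.1) ∧ (e.symm ((e ∅).succAbove x.2.1)).erase x.2.2.1 ⊆ Aᶜ ∧
        ((e.symm ((e ∅).succAbove x.2.1)).erase x.2.2.1).card = k₀ ∧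
        e.symm ((e univ).succAbove x.1) = A ∪ (e.symm ((e ∅).succAbove x.2.1)).erase x.2.2.1 ∧ (x.2.2.2 : ℕ) = k₀) ∧ (x.2.2.1 = q ∧ (e.symm ((e ∅).succAbove x.2.1)).erase x.2.2.1 ≠ C₀)) from fun x _ => ⟨fun ⟨⟨a, b⟩, c⟩ => ⟨a, b, c⟩, fun ⟨a, b, c⟩ => ⟨⟨a, b⟩, c⟩⟩)]
    ring
  -- the fiberwise decompositions `Tρ q = Σ_{C'} ρ C' q`, `Tκ q = Σ_{C'} κ C' q`
  have hTρ : ∀ q : Fin n, (fun q : Fin n => (∑ x ∈ univ.filter (fun x : Fin N × Fin N × (Fin n × Fin n) => (x.2.2.1 ∉ e.symm ((e univ).succAbove x.1) ∧ e.symm ((e ∅).succAbove x.2.1) ⊆ Aᶜ ∧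
        (e.symm ((e ∅).succAbove x.2.1)).card = k₀ ∧
        insert x.2.2.1 (e.symm ((e univ).succAbove x.1)) = A ∪ e.symm ((e ∅).succAbove x.2.1) ∧ (x.2.2.2 : ℕ) = u - 1) ∧ (x.2.2.1 = q)), A' x.2.2 x.1 x.2.1)) q = ∑ C' ∈ Finset.powersetCard k₀ Aᶜ, (fun (C' : Finset (Fin n)) (q : Fin n) => (∑ x ∈ univ.filter (fun x : Fin N × Fin N × (Fin n × Fin n) => (x.2.2.1 ∉ e.symm ((e univ).succAbove x.1) ∧ e.symm ((e ∅).succAbove x.2.1) ⊆ Aᶜ ∧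
        (e.symm ((e ∅).succAbove x.2.1)).card = k₀ ∧
        insert x.2.2.1 (e.symm ((e univ).succAbove x.1)) = A ∪ e.symm ((e ∅).succAbove x.2.1) ∧ (x.2.2.2 : ℕ) = u - 1) ∧ (e.symm ((e ∅).succAbove x.2.1) = C' ∧ x.2.2.1 = q)), A' x.2.2 x.1 x.2.1)) C' q := by
    intro q
    simp only
    rw [← Finset.sum_fiberwise_of_maps_to (s := univ.filter fun x : Fin N × Fin N × (Fin n × Fin n) => (x.2.2.1 ∉ e.symm ((e univ).succAbove x.1) ∧ e.symm ((e ∅).succAbove x.2.1) ⊆ Aᶜ ∧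
        (e.symm ((e ∅).succAbove x.2.1)).card = k₀ ∧
        insert x.2.2.1 (e.symm ((e univ).succAbove x.1)) = A ∪ e.symm ((e ∅).succAbove x.2.1) ∧ (x.2.2.2 : ℕ) = u - 1) ∧ x.2.2.1 = q)
      (t := Finset.powersetCard k₀ Aᶜ) (g := fun x : Fin N × Fin N × (Fin n × Fin n) => e.symm ((e ∅).succAbove x.2.1))
      (fun x hx => by
        obtain ⟨⟨-, h2, h3, -, -⟩, -⟩ := (Finset.mem_filter.mp hx).2
        exact Finset.mem_powersetCard.mpr ⟨h2, h3⟩)]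
    refine Finset.sum_congr rfl fun C' _ => ?_
    rw [Finset.filter_filter]
    exact Finset.sum_congr (Finset.filter_congr fun x _ =>
      ⟨fun ⟨⟨a, b⟩, c⟩ => ⟨a, c, b⟩, fun ⟨a, c, b⟩ => ⟨⟨a, b⟩, c⟩⟩) fun _ _ => rfl
  have hTκ : ∀ q : Fin n, (fun q : Fin n => (∑ x ∈ univ.filter (fun x : Fin N × Fin N × (Fin n × Fin n) => (x.2.2.1 ∈ e.symm ((e ∅).succAbove x.2.1) ∧ (e.symm ((e ∅).succAbove x.2.1)).erase x.2.2.1 ⊆ Aᶜ ∧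
        ((e.symm ((e ∅).succAbove x.2.1)).erase x.2.2.1).card = k₀ ∧
        e.symm ((e univ).succAbove x.1) = A ∪ (e.symm ((e ∅).succAbove x.2.1)).erase x.2.2.1 ∧ (x.2.2.2 : ℕ) = k₀) ∧ (x.2.2.1 = q)), A' x.2.2 x.1 x.2.1)) q = ∑ C' ∈ Finset.powersetCard k₀ Aᶜ, (fun (C' : Finset (Fin n)) (q : Fin n) => (∑ x ∈ univ.filter (fun x : Fin N × Fin N × (Fin n × Fin n) => (x.2.2.1 ∈ e.symm ((e ∅).succAbove x.2.1) ∧ (e.symm ((e ∅).succAbove x.2.1)).erase x.2.2.1 ⊆ Aᶜ ∧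
        ((e.symm ((e ∅).succAbove x.2.1)).erase x.2.2.1).card = k₀ ∧
        e.symm ((e univ).succAbove x.1) = A ∪ (e.symm ((e ∅).succAbove x.2.1)).erase x.2.2.1 ∧ (x.2.2.2 : ℕ) = k₀) ∧ ((e.symm ((e ∅).succAbove x.2.1)).erase x.2.2.1 = C' ∧ x.2.2.1 = q)), A' x.2.2 x.1 x.2.1)) C' q := by
    intro q
    simp only
    rw [← Finset.sum_fiberwise_of_maps_to (s := univ.filter fun x : Fin N × Fin N × (Fin n × Fin n) => (x.2.2.1 ∈ e.symm ((e ∅).succAbove x.2.1) ∧ (e.symm ((e ∅).succAbove x.2.1)).erase x.2.2.1 ⊆ Aᶜ ∧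
        ((e.symm ((e ∅).succAbove x.2.1)).erase x.2.2.1).card = k₀ ∧
        e.symm ((e univ).succAbove x.1) = A ∪ (e.symm ((e ∅).succAbove x.2.1)).erase x.2.2.1 ∧ (x.2.2.2 : ℕ) = k₀) ∧ x.2.2.1 = q)
      (t := Finset.powersetCard k₀ Aᶜ) (g := fun x : Fin N × Fin N × (Fin n × Fin n) => (e.symm ((e ∅).succAbove x.2.1)).erase x.2.2.1)
      (fun x hx => by
        obtain ⟨⟨-, h2, h3, -, -⟩, -⟩ := (Finset.mem_filter.mp hx).2
        exact Finset.mem_powersetCard.mpr ⟨h2, h3⟩)]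
    refine Finset.sum_congr rfl fun C' _ => ?_
    rw [Finset.filter_filter]
    exact Finset.sum_congr (Finset.filter_congr fun x _ =>
      ⟨fun ⟨⟨a, b⟩, c⟩ => ⟨a, c, b⟩, fun ⟨a, c, b⟩ => ⟨⟨a, b⟩, c⟩⟩) fun _ _ => rfl
  -- E1 for every core and every admissible pair of letters
  have hE1 : ∀ C₀ ∈ Finset.powersetCard k₀ Aᶜ, ∀ αf ∈ A, ∀ αl ∈ A, (αf ≠ αl ∨ A.card = 1) →
      ((fun q : Fin n => (∑ x ∈ univ.filter (fun x : Fin N × Fin N × (Fin n × Fin n) => (x.2.2.1 ∉ e.symm ((e univ).succAbove x.1) ∧ e.symm ((e ∅).succAbove x.2.1) ⊆ Aᶜ ∧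
        (e.symm ((e ∅).succAbove x.2.1)).card = k₀ ∧
        insert x.2.2.1 (e.symm ((e univ).succAbove x.1)) = A ∪ e.symm ((e ∅).succAbove x.2.1) ∧ (x.2.2.2 : ℕ) = u - 1) ∧ (x.2.2.1 = q)), A' x.2.2 x.1 x.2.1)) αl - (fun (C' : Finset (Fin n)) (q : Fin n) => (∑ x ∈ univ.filter (fun x : Fin N × Fin N × (Fin n × Fin n) => (x.2.2.1 ∉ e.symm ((e univ).succAbove x.1) ∧ e.symm ((e ∅).succAbove x.2.1) ⊆ Aᶜ ∧
        (e.symm ((e ∅).succAbove x.2.1)).card = k₀ ∧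
        insert x.2.2.1 (e.symm ((e univ).succAbove x.1)) = A ∪ e.symm ((e ∅).succAbove x.2.1) ∧ (x.2.2.2 : ℕ) = u - 1) ∧ (e.symm ((e ∅).succAbove x.2.1) = C' ∧ x.2.2.1 = q)), A' x.2.2 x.1 x.2.1)) C₀ αl) + ((fun q : Fin n => (∑ x ∈ univ.filter (fun x : Fin N × Fin N × (Fin n × Fin n) => (x.2.2.1 ∈ e.symm ((e ∅).succAbove x.2.1) ∧ (e.symm ((e ∅).succAbove x.2.1)).erase x.2.2.1 ⊆ Aᶜ ∧
        ((e.symm ((e ∅).succAbove x.2.1)).erase x.2.2.1).card = k₀ ∧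
        e.symm ((e univ).succAbove x.1) = A ∪ (e.symm ((e ∅).succAbove x.2.1)).erase x.2.2.1 ∧ (x.2.2.2 : ℕ) = k₀) ∧ (x.2.2.1 = q)), A' x.2.2 x.1 x.2.1)) αf - (fun (C' : Finset (Fin n)) (q : Fin n) => (∑ x ∈ univ.filter (fun x : Fin N × Fin N × (Fin n × Fin n) => (x.2.2.1 ∈ e.symm ((e ∅).succAbove x.2.1) ∧ (e.symm ((e ∅).succAbove x.2.1)).erase x.2.2.1 ⊆ Aᶜ ∧
        ((e.symm ((e ∅).succAbove x.2.1)).erase x.2.2.1).card = k₀ ∧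
        e.symm ((e univ).succAbove x.1) = A ∪ (e.symm ((e ∅).succAbove x.2.1)).erase x.2.2.1 ∧ (x.2.2.2 : ℕ) = k₀) ∧ ((e.symm ((e ∅).succAbove x.2.1)).erase x.2.2.1 = C' ∧ x.2.2.1 = q)), A' x.2.2 x.1 x.2.1)) C₀ αf) = 0 := by
    intro C₀ hC₀ αf hαf αl hαl hne
    obtain ⟨hC₀A, hC₀k⟩ := Finset.mem_powersetCard.mp hC₀
    obtain ⟨π, hp1, hpA, hπf, hπl⟩ := exists_perm_designE1 A C₀ hC₀A hαf hαl hne hC₀k huA hkn hul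
    have hE := grenet_blockII_E1 e hn hN A' htr hsupp A hA k₀ huA hu hul hkn π (hp1.symm ▸ hC₀A) hpA
    simp only [hp1, hπf, hπl] at hE
    simp only
    rw [← splitT C₀ αl, ← splitH C₀ αf]
    exact hE
  -- E2 at the core `T`
  have hE2 : ∀ φ ∈ T, ∀ αₐ ∈ A, ∃ α₁ ∈ A, (α₁ ≠ αₐ ∨ A.card = 1) ∧
      ((fun q : Fin n => (∑ x ∈ univ.filter (fun x : Fin N × Fin N × (Fin n × Fin n) => (x.2.2.1 ∉ e.symm ((e univ).succAbove x.1) ∧ e.symm ((e ∅).succAbove x.2.1) ⊆ Aᶜ ∧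
        (e.symm ((e ∅).succAbove x.2.1)).card = k₀ ∧
        insert x.2.2.1 (e.symm ((e univ).succAbove x.1)) = A ∪ e.symm ((e ∅).succAbove x.2.1) ∧ (x.2.2.2 : ℕ) = u - 1) ∧ (x.2.2.1 = q)), A' x.2.2 x.1 x.2.1)) αₐ - (fun (C' : Finset (Fin n)) (q : Fin n) => (∑ x ∈ univ.filter (fun x : Fin N × Fin N × (Fin n × Fin n) => (x.2.2.1 ∉ e.symm ((e univ).succAbove x.1) ∧ e.symm ((e ∅).succAbove x.2.1) ⊆ Aᶜ ∧
        (e.symm ((e ∅).succAbove x.2.1)).card = k₀ ∧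
        insert x.2.2.1 (e.symm ((e univ).succAbove x.1)) = A ∪ e.symm ((e ∅).succAbove x.2.1) ∧ (x.2.2.2 : ℕ) = u - 1) ∧ (e.symm ((e ∅).succAbove x.2.1) = C' ∧ x.2.2.1 = q)), A' x.2.2 x.1 x.2.1)) T φ) + ((fun q : Fin n => (∑ x ∈ univ.filter (fun x : Fin N × Fin N × (Fin n × Fin n) => (x.2.2.1 ∈ e.symm ((e ∅).succAbove x.2.1) ∧ (e.symm ((e ∅).succAbove x.2.1)).erase x.2.2.1 ⊆ Aᶜ ∧
        ((e.symm ((e ∅).succAbove x.2.1)).erase x.2.2.1).card = k₀ ∧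
        e.symm ((e univ).succAbove x.1) = A ∪ (e.symm ((e ∅).succAbove x.2.1)).erase x.2.2.1 ∧ (x.2.2.2 : ℕ) = k₀) ∧ (x.2.2.1 = q)), A' x.2.2 x.1 x.2.1)) α₁ - (fun (C' : Finset (Fin n)) (q : Fin n) => (∑ x ∈ univ.filter (fun x : Fin N × Fin N × (Fin n × Fin n) => (x.2.2.1 ∈ e.symm ((e ∅).succAbove x.2.1) ∧ (e.symm ((e ∅).succAbove x.2.1)).erase x.2.2.1 ⊆ Aᶜ ∧
        ((e.symm ((e ∅).succAbove x.2.1)).erase x.2.2.1).card = k₀ ∧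
        e.symm ((e univ).succAbove x.1) = A ∪ (e.symm ((e ∅).succAbove x.2.1)).erase x.2.2.1 ∧ (x.2.2.2 : ℕ) = k₀) ∧ ((e.symm ((e ∅).succAbove x.2.1)).erase x.2.2.1 = C' ∧ x.2.2.1 = q)), A' x.2.2 x.1 x.2.1)) T α₁) = 0 := by
    intro φ hφ αₐ hαₐ
    obtain ⟨π, c₁, hc₁, hπc₁, hs1, hs2, hs3⟩ := exists_perm_designE2 A T hTA hφ hαₐ hTk huA
    obtain ⟨α₁, hα₁, hα₁'⟩ : ∃ α₁ : Fin n, (k₀ < u - 1 → α₁ = π ⟨k₀, hkn⟩) ∧ (u - 1 = k₀ → α₁ = αₐ) := by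
      by_cases h : k₀ < u - 1
      · exact ⟨π ⟨k₀, hkn⟩, fun _ => rfl, fun h' => absurd h' (by omega)⟩
      · exact ⟨αₐ, fun h' => absurd h' h, fun _ => rfl⟩
    have hαA : α₁ ∈ A ∧ (α₁ ≠ αₐ ∨ A.card = 1) := by
      rcases Nat.lt_or_ge k₀ (u - 1) with hlt' | hge'
      · have h1 := hα₁ hlt'
        have : π ⟨k₀, hkn⟩ ∈ (univ.filter fun c : Fin n => k₀ ≤ (c : ℕ) ∧ (c : ℕ) < u - 1).image π := by
          rw [mem_permSlice, Equiv.symm_apply_apply]; exact ⟨le_rfl, hlt'⟩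
        rw [permSlice_eq_sdiff π (by omega), hs2, hs1, ← h1, Finset.mem_sdiff, Finset.mem_erase, Finset.mem_union,
          Finset.mem_insert, not_or] at this
        obtain ⟨⟨hne', hA' | hT'⟩, hnα, hnC⟩ := this
        · exact ⟨hA', Or.inl hnα⟩
        · exact absurd (Finset.mem_erase.mpr ⟨hne', hT'⟩) hnC
      · exact ⟨(hα₁' (by omega)).symm ▸ hαₐ, Or.inr (by omega)⟩
    exact ⟨α₁, hαA.1, hαA.2, grenet_blockII_E2 e hn hN A' htr hsupp A hA k₀ huA hu hul hkn T hTA φ αₐ hφ hαₐ π c₁ hc₁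
      hπc₁ hs1 hs2 hs3 α₁ hα₁ hα₁'⟩
  -- E3 at the core `T`
  have hE3 : ∀ φ', φ' ∉ A → φ' ∉ T → ∀ α₁ ∈ A, ∃ αₐ ∈ A, (α₁ ≠ αₐ ∨ A.card = 1) ∧
      ((fun q : Fin n => (∑ x ∈ univ.filter (fun x : Fin N × Fin N × (Fin n × Fin n) => (x.2.2.1 ∉ e.symm ((e univ).succAbove x.1) ∧ e.symm ((e ∅).succAbove x.2.1) ⊆ Aᶜ ∧
        (e.symm ((e ∅).succAbove x.2.1)).card = k₀ ∧
        insert x.2.2.1 (e.symm ((e univ).succAbove x.1)) = A ∪ e.symm ((e ∅).succAbove x.2.1) ∧ (x.2.2.2 : ℕ) = u - 1) ∧ (x.2.2.1 = q)), A' x.2.2 x.1 x.2.1)) αₐ - (fun (C' : Finset (Fin n)) (q : Fin n) => (∑ x ∈ univ.filter (fun x : Fin N × Fin N × (Fin n × Fin n) => (x.2.2.1 ∉ e.symm ((e univ).succAbove x.1) ∧ e.symm ((e ∅).succAbove x.2.1) ⊆ Aᶜ ∧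
        (e.symm ((e ∅).succAbove x.2.1)).card = k₀ ∧
        insert x.2.2.1 (e.symm ((e univ).succAbove x.1)) = A ∪ e.symm ((e ∅).succAbove x.2.1) ∧ (x.2.2.2 : ℕ) = u - 1) ∧ (e.symm ((e ∅).succAbove x.2.1) = C' ∧ x.2.2.1 = q)), A' x.2.2 x.1 x.2.1)) T αₐ) + ((fun q : Fin n => (∑ x ∈ univ.filter (fun x : Fin N × Fin N × (Fin n × Fin n) => (x.2.2.1 ∈ e.symm ((e ∅).succAbove x.2.1) ∧ (e.symm ((e ∅).succAbove x.2.1)).erase x.2.2.1 ⊆ Aᶜ ∧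
        ((e.symm ((e ∅).succAbove x.2.1)).erase x.2.2.1).card = k₀ ∧
        e.symm ((e univ).succAbove x.1) = A ∪ (e.symm ((e ∅).succAbove x.2.1)).erase x.2.2.1 ∧ (x.2.2.2 : ℕ) = k₀) ∧ (x.2.2.1 = q)), A' x.2.2 x.1 x.2.1)) α₁ - (fun (C' : Finset (Fin n)) (q : Fin n) => (∑ x ∈ univ.filter (fun x : Fin N × Fin N × (Fin n × Fin n) => (x.2.2.1 ∈ e.symm ((e ∅).succAbove x.2.1) ∧ (e.symm ((e ∅).succAbove x.2.1)).erase x.2.2.1 ⊆ Aᶜ ∧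
        ((e.symm ((e ∅).succAbove x.2.1)).erase x.2.2.1).card = k₀ ∧
        e.symm ((e univ).succAbove x.1) = A ∪ (e.symm ((e ∅).succAbove x.2.1)).erase x.2.2.1 ∧ (x.2.2.2 : ℕ) = k₀) ∧ ((e.symm ((e ∅).succAbove x.2.1)).erase x.2.2.1 = C' ∧ x.2.2.1 = q)), A' x.2.2 x.1 x.2.1)) T φ') = 0 := by
    intro φ' hφ'A hφ'T α₁ hα₁
    obtain ⟨π, hπk, hπu, ht1, ht2, ht3⟩ := exists_perm_designE3 A T hTA hφ'A hφ'T hα₁ hTk huA hkn hun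
    obtain ⟨αₐ, hαₐ, hαₐ'⟩ : ∃ αₐ : Fin n, (k₀ < u - 1 → αₐ = π ⟨u - 1, hul⟩) ∧ (u - 1 = k₀ → αₐ = α₁) := by
      by_cases h : k₀ < u - 1
      · exact ⟨π ⟨u - 1, hul⟩, fun _ => rfl, fun h' => absurd h' (by omega)⟩
      · exact ⟨α₁, fun h' => absurd h' h, fun _ => rfl⟩
    have hαA : αₐ ∈ A ∧ (α₁ ≠ αₐ ∨ A.card = 1) := by
      rcases Nat.lt_or_ge k₀ (u - 1) with hlt' | hge'
      · have h1 := hαₐ hlt'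
        have : π ⟨u - 1, hul⟩ ∈ (univ.filter fun c : Fin n => k₀ + 1 ≤ (c : ℕ) ∧ (c : ℕ) < u).image π := by
          rw [mem_permSlice, Equiv.symm_apply_apply]; simp only; omega
        rw [permSlice_eq_sdiff π (by omega), ht3, ht2, ← h1, Finset.mem_sdiff, Finset.mem_insert, Finset.mem_union,
          Finset.mem_insert, not_or] at this
        obtain ⟨hx | hx | hx, hnφ, hnT⟩ := this
        · exact absurd hx hnφ
        · exact absurd hx hnT
        · exact ⟨Finset.mem_of_mem_erase hx, Or.inl (Finset.ne_of_mem_erase hx).symm⟩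
      · exact ⟨(hαₐ' (by omega)).symm ▸ hα₁, Or.inr (by omega)⟩
    have hE := grenet_blockII_E3 e hn hN A' htr hsupp A hA k₀ huA hul hkn hun T hTA φ' α₁ hφ'A hφ'T hα₁ π hπk hπu
      ht1 ht2 ht3 αₐ hαₐ hαₐ'
    rw [swapT T αₐ] at hE
    exact ⟨αₐ, hαA.1, hαA.2, hE⟩
  -- the algebra of the block
  have key := blockII_filterAlgebra (Finset.powersetCard k₀ Aᶜ) T hT𝒞 h2 A T hAne ⟨φ₀, hφ₀⟩ (fun (C' : Finset (Fin n)) (q : Fin n) => (∑ x ∈ univ.filter (fun x : Fin N × Fin N × (Fin n × Fin n) => (x.2.2.1 ∉ e.symm ((e univ).succAbove x.1) ∧ e.symm ((e ∅).succAbove x.2.1) ⊆ Aᶜ ∧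
        (e.symm ((e ∅).succAbove x.2.1)).card = k₀ ∧
        insert x.2.2.1 (e.symm ((e univ).succAbove x.1)) = A ∪ e.symm ((e ∅).succAbove x.2.1) ∧ (x.2.2.2 : ℕ) = u - 1) ∧ (e.symm ((e ∅).succAbove x.2.1) = C' ∧ x.2.2.1 = q)), A' x.2.2 x.1 x.2.1)) (fun (C' : Finset (Fin n)) (q : Fin n) => (∑ x ∈ univ.filter (fun x : Fin N × Fin N × (Fin n × Fin n) => (x.2.2.1 ∈ e.symm ((e ∅).succAbove x.2.1) ∧ (e.symm ((e ∅).succAbove x.2.1)).erase x.2.2.1 ⊆ Aᶜ ∧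
        ((e.symm ((e ∅).succAbove x.2.1)).erase x.2.2.1).card = k₀ ∧
        e.symm ((e univ).succAbove x.1) = A ∪ (e.symm ((e ∅).succAbove x.2.1)).erase x.2.2.1 ∧ (x.2.2.2 : ℕ) = k₀) ∧ ((e.symm ((e ∅).succAbove x.2.1)).erase x.2.2.1 = C' ∧ x.2.2.1 = q)), A' x.2.2 x.1 x.2.1)) (fun q : Fin n => (∑ x ∈ univ.filter (fun x : Fin N × Fin N × (Fin n × Fin n) => (x.2.2.1 ∉ e.symm ((e univ).succAbove x.1) ∧ e.symm ((e ∅).succAbove x.2.1) ⊆ Aᶜ ∧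
        (e.symm ((e ∅).succAbove x.2.1)).card = k₀ ∧
        insert x.2.2.1 (e.symm ((e univ).succAbove x.1)) = A ∪ e.symm ((e ∅).succAbove x.2.1) ∧ (x.2.2.2 : ℕ) = u - 1) ∧ (x.2.2.1 = q)), A' x.2.2 x.1 x.2.1)) (fun q : Fin n => (∑ x ∈ univ.filter (fun x : Fin N × Fin N × (Fin n × Fin n) => (x.2.2.1 ∈ e.symm ((e ∅).succAbove x.2.1) ∧ (e.symm ((e ∅).succAbove x.2.1)).erase x.2.2.1 ⊆ Aᶜ ∧
        ((e.symm ((e ∅).succAbove x.2.1)).erase x.2.2.1).card = k₀ ∧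
        e.symm ((e univ).succAbove x.1) = A ∪ (e.symm ((e ∅).succAbove x.2.1)).erase x.2.2.1 ∧ (x.2.2.2 : ℕ) = k₀) ∧ (x.2.2.1 = q)), A' x.2.2 x.1 x.2.1))
    hTρ hTκ hE1 hE2 hE3 v.1 (by rw [← Finset.mem_union, hAU]; exact hpU) v'.1 hp'T
  -- the two entries are the singletons `κ T v'.1` and `ρ T v.1`
  have hκ : ∑ x ∈ univ.filter (fun x : Fin N × Fin N × (Fin n × Fin n) => (x.2.2.1 ∈ e.symm ((e ∅).succAbove x.2.1) ∧ (e.symm ((e ∅).succAbove x.2.1)).erase x.2.2.1 ⊆ Aᶜ ∧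
        ((e.symm ((e ∅).succAbove x.2.1)).erase x.2.2.1).card = k₀ ∧
        e.symm ((e univ).succAbove x.1) = A ∪ (e.symm ((e ∅).succAbove x.2.1)).erase x.2.2.1 ∧ (x.2.2.2 : ℕ) = k₀) ∧ ((e.symm ((e ∅).succAbove x.2.1)).erase x.2.2.1 = T ∧ x.2.2.1 = v'.1)), A' x.2.2 x.1 x.2.1 = A' v' i' j' := by
    refine Finset.sum_eq_single_of_mem ((i', j', v') : Fin N × Fin N × (Fin n × Fin n)) ?_ fun x hx hne => absurd ?_ hne
    · refine Finset.mem_filter.mpr ⟨Finset.mem_univ _, ⟨hh.1, ?_, ?_, ?_, hv'2⟩, ?_, rfl⟩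
      · rw [hCj', Finset.erase_insert hp'T]; exact hTA
      · rw [hCj', Finset.erase_insert hp'T, hTk]
      · rw [hUdef, hCj', Finset.erase_insert hp'T, hAU]
      · rw [hCj', Finset.erase_insert hp'T]
    · obtain ⟨⟨g1, -, -, g4, g5⟩, g6, g7⟩ := (Finset.mem_filter.mp hx).2
      have hx21 : x.2.1 = j' := hCinj _ _ (by rw [hCj', ← g6, g7, Finset.insert_erase (g7 ▸ g1)])
      have hx1 : x.1 = i' := hRinj _ _ (by rw [hUdef, g4, g6, hAU])
      have hx22 : x.2.2 = v' := Prod.ext g7 (Fin.ext (by rw [g5, hv'2]))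
      rcases x with ⟨x1, x21, x22⟩
      simp only at hx1 hx21 hx22
      rw [hx1, hx21, hx22]
  have hρ : ∑ x ∈ univ.filter (fun x : Fin N × Fin N × (Fin n × Fin n) => (x.2.2.1 ∉ e.symm ((e univ).succAbove x.1) ∧ e.symm ((e ∅).succAbove x.2.1) ⊆ Aᶜ ∧
        (e.symm ((e ∅).succAbove x.2.1)).card = k₀ ∧
        insert x.2.2.1 (e.symm ((e univ).succAbove x.1)) = A ∪ e.symm ((e ∅).succAbove x.2.1) ∧ (x.2.2.2 : ℕ) = u - 1) ∧ (e.symm ((e ∅).succAbove x.2.1) = T ∧ x.2.2.1 = v.1)), A' x.2.2 x.1 x.2.1 = A' v i j := by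
    refine Finset.sum_eq_single_of_mem ((i, j, v) : Fin N × Fin N × (Fin n × Fin n)) ?_ fun x hx hne => absurd ?_ hne
    · refine Finset.mem_filter.mpr ⟨Finset.mem_univ _, ⟨ht.1, ?_, ?_, ?_, hv2⟩, hTdef, rfl⟩
      · rw [hTdef]; exact hTA
      · rw [hTdef, hTk]
      · rw [hU, hTdef, hAU]
    · obtain ⟨⟨g1, -, -, g4, g5⟩, g6, g7⟩ := (Finset.mem_filter.mp hx).2
      have hx21 : x.2.1 = j := hCinj _ _ (by rw [g6, hTdef])
      have hx1 : x.1 = i := hRinj _ _ (by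
        rw [hS, ← hAU, ← g6, ← g4, g7, Finset.erase_insert (g7 ▸ g1)])
      have hx22 : x.2.2 = v := Prod.ext g7 (Fin.ext (by rw [g5, hv2]))
      rcases x with ⟨x1, x21, x22⟩
      simp only at hx1 hx21 hx22
      rw [hx1, hx21, hx22]
  rw [hκ, hρ] at key
  exact eq_neg_of_add_eq_zero_left key

end Summit.ValiantsHypothesis.Theorems.RigidityForcesSymmetry.GrenetGauge
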